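import Mathlib
import Summits.Ventures.HodgeRepro.Tier4.Target
import Summits.Ventures.HodgeRepro.Tier4.Common.TargetBall
import Summits.Ventures.HodgeRepro.Tier4.Common.TargetCalculus
import Summits.Ventures.HodgeRepro.Tier4.Common.TargetJacobian
import Summits.Ventures.HodgeRepro.Tier4.Common.AutForms
import Summits.Ventures.HodgeRepro.Tier4.Line3.BallChangeOfVariables
import Summits.Ventures.HodgeRepro.Tier4.Line3.DomainTransfer
import Summits.Ventures.HodgeRepro.Tier4.Line3.KernelIntegrable

/-!
# Tier4/Line3/InvariantDensityTransfer — the integral of a `Γ′`-invariant density does not depend on the fundamental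
domain (transfer R6, part 2, in `ℝ≥0∞`)

Blind re-derivation cell `pub-hodge-repro`, Tier 4 «PROVE THE STEP» (README §9–§10), LINE L3, seat t4-L2-p1 (on L3.5
with t4-L2-p3, lead S12654); support module for the residual `OffMainMass` of L3.5 (`TermDominatedAssembly`), shared
with L3.4 / L3.6a.  Mathlib-level: nothing of the line's data enters; it completes t4-L3-p1's `DomainTransfer` (the
tiling `∫_𝔹 G = Σ'_φ ∫_{φ(D)} G`, Bochner) by its `ℝ≥0∞` twin and the consequence the analysis needs:

* the `ℝ≥0∞` change of variables `lintegral_image_actM` is t4-L3-p1's (`KernelIntegrable`, imported by name);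
* `lintegral_ball_eq_tsum_image_generic`: the tiling of the ball by the translates of a fundamental domain of ANY
  congruence subgroup, for every `ℝ≥0∞`-valued function (`lintegral_iUnion₀` on t4-L3-p1's `ball_ae_eq_iUnion_image`;
  t4-L3-p1's `T4Data.lintegral_ball_eq_tsum_image` is the instance for a level of the line's data);
* **`lintegral_fundamentalDomain_eq`**: for two fundamental domains `D`, `D′` of `Γ′` (`IsFundamentalDomainFor`) and a
  measurable density `ρ` with `|det Jac φ|² · ρ ∘ φ = ρ` on the ball for every `φ ∈ ballActions τ₀ C Γ′`,
  `∫⁻_D ρ = ∫⁻_{D′} ρ`.  PROOF of `≤`: almost every `z ∈ D` has some `φ z ∈ D′` (the covering clause of `D′`), so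
  `ρ ≤ ρ · Σ_φ 1_{D′} ∘ φ` a.e. on `D`; by invariance `ρ(z) 1_{D′}(φ z) = |det Jac φ (z)|² (1_{D′} ρ)(φ z)`, which
  pulls back to `∫⁻_{φ(D)} 1_{D′} ρ`; the tiles `φ(D)` are almost disjoint and cover the ball, so the sum is
  `∫⁻_𝔹 1_{D′} ρ = ∫⁻_{D′} ρ`.  No uniqueness of the translate is needed; `≥` is the same with `D`, `D′` swapped.

This is the step that makes the off-main mass of L3.5 (and the orbital integrals of L3.4 / L3.6a) independent of WHICH
relatively compact fundamental domain `T4Data.domain` chose (t4-L2-p3's caveat S12794).  Nothing here asserts anything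
about the truth of (P); HC_CM is NOT proved by anyone in this repository.
-/

set_option autoImplicit false

noncomputable section

namespace Summit.Ventures.HodgeRepro.Tier4.Line3

open Summit.Ventures.HodgeRepro.Tier4
open Matrix MeasureTheory
open scoped ComplexConjugate ENNReal

/-! ## 1. Change of variables in `ℝ≥0∞` -/

section Image

variable {M : Matrix (Fin 3) (Fin 3) ℂ}

/-- The action map is measurable (its coordinates are quotients of affine functions). -/
theorem measurable_actM (M : Matrix (Fin 3) (Fin 3) ℂ) : Measurable (actM M) := by
  refine measurable_pi_iff.mpr fun k => ?_
  have hnum : Measurable fun z : Fin 2 → ℂ => (M *ᵥ lift3 z) (Fin.castSucc k) :=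
    (differentiable_mulVec_lift3 M _).continuous.measurable
  have hden : Measurable fun z : Fin 2 → ℂ => (M *ᵥ lift3 z) 2 :=
    (differentiable_mulVec_lift3 M 2).continuous.measurable
  exact hnum.div hden

end Image

/-! ## 2. The tiling in `ℝ≥0∞` and the transfer -/

section Transfer

variable {E : Type*} [Field E] [NumberField E] {c : E ≃+* E} {H : Matrix (Fin 3) (Fin 3) E} {τ₀ : E →+* ℂ}
  {C : Matrix (Fin 3) (Fin 3) ℂ} {Γ' : Set (Matrix (Fin 3) (Fin 3) E)}

/-- **THE TILING in `ℝ≥0∞`**: `∫⁻_𝔹 f = Σ'_φ ∫⁻_{φ(D)} f` over `φ ∈ ballActions τ₀ C Γ′`, for every `f`. -/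
theorem lintegral_ball_eq_tsum_image_generic (hΓ : IsCongruenceSubgroup c H Γ') (hτ : ∀ x, τ₀ (c x) = conj (τ₀ x))
    (hC : IsSylvester (H.map τ₀) C) {D : Set (Fin 2 → ℂ)} (hD : IsFundamentalDomainFor (ballActions τ₀ C Γ') D)
    (f : (Fin 2 → ℂ) → ℝ≥0∞) :
    ∫⁻ z in ball, f z = ∑' φ : ballActions τ₀ C Γ', ∫⁻ z in φ.1 '' D, f z := by
  haveI : Countable (ballActions τ₀ C Γ') := countable_ballActions
  have hmeas : ∀ φ : ballActions τ₀ C Γ', MeasurableSet (φ.1 '' D) := by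
    intro φ
    obtain ⟨M, hM, hφ⟩ := exists_unitaryJ_of_mem_ballActions hΓ hτ hC φ.2
    rw [hφ]
    exact measurableSet_image_actM hM hD.1 hD.2.1
  rw [setLIntegral_congr (ball_ae_eq_iUnion_image hΓ hτ hC hD)]
  exact lintegral_iUnion₀ (fun φ => (hmeas φ).nullMeasurableSet)
    (fun φ ψ hne => hD.2.2.2 φ.1 φ.2 ψ.1 ψ.2 (fun h => hne (Subtype.ext h))) f

/-- A `Γ′`-invariant density: `|det Jac φ|² · ρ ∘ φ = ρ` on the ball, for every `φ ∈ ballActions τ₀ C Γ′`. -/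
def IsInvariantDensity (τ₀ : E →+* ℂ) (C : Matrix (Fin 3) (Fin 3) ℂ) (Γ' : Set (Matrix (Fin 3) (Fin 3) E))
    (ρ : (Fin 2 → ℂ) → ℝ≥0∞) : Prop :=
  ∀ φ ∈ ballActions τ₀ C Γ', ∀ z ∈ ball, ENNReal.ofReal (Complex.normSq (jacDetMap φ z)) * ρ (φ z) = ρ z

/-- **ONE HALF OF THE TRANSFER**: `∫⁻_D ρ ≤ ∫⁻_{D′} ρ` for two fundamental domains and an invariant measurable density. -/
theorem lintegral_fundamentalDomain_le (hΓ : IsCongruenceSubgroup c H Γ') (hτ : ∀ x, τ₀ (c x) = conj (τ₀ x))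
    (hC : IsSylvester (H.map τ₀) C) {D D' : Set (Fin 2 → ℂ)}
    (hD : IsFundamentalDomainFor (ballActions τ₀ C Γ') D) (hD' : IsFundamentalDomainFor (ballActions τ₀ C Γ') D')
    {ρ : (Fin 2 → ℂ) → ℝ≥0∞} (hρm : Measurable ρ) (hρ : IsInvariantDensity τ₀ C Γ' ρ) :
    ∫⁻ z in D, ρ z ≤ ∫⁻ z in D', ρ z := by
  haveI : Countable (ballActions τ₀ C Γ') := countable_ballActions
  -- the indicator of `D′` composed with the translates
  let χ : ballActions τ₀ C Γ' → (Fin 2 → ℂ) → ℝ≥0∞ := fun φ z => D'.indicator (fun _ => (1 : ℝ≥0∞)) (φ.1 z)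
  have hχm : ∀ φ : ballActions τ₀ C Γ', Measurable (χ φ) := by
    intro φ
    obtain ⟨M, _, hφ⟩ := exists_unitaryJ_of_mem_ballActions hΓ hτ hC φ.2
    show Measurable (fun z => D'.indicator (fun _ => (1 : ℝ≥0∞)) (φ.1 z))
    rw [hφ]
    exact (measurable_const.indicator hD'.1).comp (measurable_actM M)
  -- almost every point of `D` has a translate in `D′`: the count is at least `1`
  have hcount : ∀ᵐ z ∂(volume.restrict D), 1 ≤ ∑' φ : ballActions τ₀ C Γ', χ φ z := by
    have h := ae_restrict_of_ae_restrict_of_subset hD.2.1 hD'.2.2.1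
    filter_upwards [h] with z hz
    obtain ⟨φ, hφ, hφz⟩ := hz
    calc (1 : ℝ≥0∞) = χ ⟨φ, hφ⟩ z := by simp [χ, Set.indicator_of_mem hφz]
      _ ≤ ∑' φ : ballActions τ₀ C Γ', χ φ z := ENNReal.le_tsum _
  -- the invariance, pointwise on `D`, turns `ρ z · 1_{D′}(φ z)` into `|det Jac φ|² · (1_{D′} ρ)(φ z)`
  have hpt : ∀ (φ : ballActions τ₀ C Γ'), ∀ z ∈ D, ρ z * χ φ z =
      ENNReal.ofReal (Complex.normSq (jacDetMap φ.1 z)) * D'.indicator ρ (φ.1 z) := by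
    intro φ z hz
    rw [← hρ φ.1 φ.2 z (hD.2.1 hz)]
    by_cases hφz : φ.1 z ∈ D'
    · simp [χ, Set.indicator_of_mem hφz]
    · simp [χ, Set.indicator_of_notMem hφz]
  calc ∫⁻ z in D, ρ z ≤ ∫⁻ z in D, ρ z * ∑' φ : ballActions τ₀ C Γ', χ φ z :=
        lintegral_mono_ae (hcount.mono fun z hz => le_mul_of_one_le_right' hz)
    _ = ∑' φ : ballActions τ₀ C Γ', ∫⁻ z in D, ρ z * χ φ z := by
        have hm : ∀ φ : ballActions τ₀ C Γ', AEMeasurable (fun z => ρ z * χ φ z) (volume.restrict D) :=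
          fun φ => (hρm.mul (hχm φ)).aemeasurable
        rw [← lintegral_tsum hm]
        exact lintegral_congr fun z => ENNReal.tsum_mul_left.symm
    _ = ∑' φ : ballActions τ₀ C Γ',
          ∫⁻ z in D, ENNReal.ofReal (Complex.normSq (jacDetMap φ.1 z)) * D'.indicator ρ (φ.1 z) :=
        tsum_congr fun φ => setLIntegral_congr_fun hD.1 (hpt φ)
    _ = ∑' φ : ballActions τ₀ C Γ', ∫⁻ w in φ.1 '' D, D'.indicator ρ w := by
        refine tsum_congr fun φ => ?_
        obtain ⟨M, hM, hφ⟩ := exists_unitaryJ_of_mem_ballActions hΓ hτ hC φ.2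
        rw [hφ, lintegral_image_actM hM hD.1 hD.2.1]
    _ = ∫⁻ w in ball, D'.indicator ρ w := (lintegral_ball_eq_tsum_image_generic hΓ hτ hC hD _).symm
    _ = ∫⁻ w in D', ρ w := by
        rw [lintegral_indicator hD'.1, Measure.restrict_restrict hD'.1, Set.inter_eq_left.mpr hD'.2.1]

/-- **THE TRANSFER**: the integral of a `Γ′`-invariant measurable density is the same over any two fundamental
domains of `Γ′`. -/
theorem lintegral_fundamentalDomain_eq (hΓ : IsCongruenceSubgroup c H Γ') (hτ : ∀ x, τ₀ (c x) = conj (τ₀ x))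
    (hC : IsSylvester (H.map τ₀) C) {D D' : Set (Fin 2 → ℂ)}
    (hD : IsFundamentalDomainFor (ballActions τ₀ C Γ') D) (hD' : IsFundamentalDomainFor (ballActions τ₀ C Γ') D')
    {ρ : (Fin 2 → ℂ) → ℝ≥0∞} (hρm : Measurable ρ) (hρ : IsInvariantDensity τ₀ C Γ' ρ) :
    ∫⁻ z in D, ρ z = ∫⁻ z in D', ρ z :=
  le_antisymm (lintegral_fundamentalDomain_le hΓ hτ hC hD hD' hρm hρ)
    (lintegral_fundamentalDomain_le hΓ hτ hC hD' hD hρm hρ)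


/-- **ONE HALF OF THE TRANSFER, a.e.-measurable version**: the density need only be a.e.-measurable on the ball (the
densities of the line are continuous on the ball and arbitrary outside it). -/
theorem lintegral_fundamentalDomain_le_ae (hΓ : IsCongruenceSubgroup c H Γ') (hτ : ∀ x, τ₀ (c x) = conj (τ₀ x))
    (hC : IsSylvester (H.map τ₀) C) {D D' : Set (Fin 2 → ℂ)}
    (hD : IsFundamentalDomainFor (ballActions τ₀ C Γ') D) (hD' : IsFundamentalDomainFor (ballActions τ₀ C Γ') D')
    {ρ : (Fin 2 → ℂ) → ℝ≥0∞} (hρm : AEMeasurable ρ (volume.restrict ball)) (hρ : IsInvariantDensity τ₀ C Γ' ρ) :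
    ∫⁻ z in D, ρ z ≤ ∫⁻ z in D', ρ z := by
  haveI : Countable (ballActions τ₀ C Γ') := countable_ballActions
  let χ : ballActions τ₀ C Γ' → (Fin 2 → ℂ) → ℝ≥0∞ := fun φ z => D'.indicator (fun _ => (1 : ℝ≥0∞)) (φ.1 z)
  have hχm : ∀ φ : ballActions τ₀ C Γ', Measurable (χ φ) := by
    intro φ
    obtain ⟨M, _, hφ⟩ := exists_unitaryJ_of_mem_ballActions hΓ hτ hC φ.2
    show Measurable (fun z => D'.indicator (fun _ => (1 : ℝ≥0∞)) (φ.1 z))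
    rw [hφ]
    exact (measurable_const.indicator hD'.1).comp (measurable_actM M)
  have hρD : AEMeasurable ρ (volume.restrict D) :=
    hρm.mono_measure (Measure.restrict_mono hD.2.1 le_rfl)
  have hcount : ∀ᵐ z ∂(volume.restrict D), 1 ≤ ∑' φ : ballActions τ₀ C Γ', χ φ z := by
    have h := ae_restrict_of_ae_restrict_of_subset hD.2.1 hD'.2.2.1
    filter_upwards [h] with z hz
    obtain ⟨φ, hφ, hφz⟩ := hz
    calc (1 : ℝ≥0∞) = χ ⟨φ, hφ⟩ z := by simp [χ, Set.indicator_of_mem hφz]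
      _ ≤ ∑' φ : ballActions τ₀ C Γ', χ φ z := ENNReal.le_tsum _
  have hpt : ∀ (φ : ballActions τ₀ C Γ'), ∀ z ∈ D, ρ z * χ φ z =
      ENNReal.ofReal (Complex.normSq (jacDetMap φ.1 z)) * D'.indicator ρ (φ.1 z) := by
    intro φ z hz
    rw [← hρ φ.1 φ.2 z (hD.2.1 hz)]
    by_cases hφz : φ.1 z ∈ D'
    · simp [χ, Set.indicator_of_mem hφz]
    · simp [χ, Set.indicator_of_notMem hφz]
  calc ∫⁻ z in D, ρ z ≤ ∫⁻ z in D, ρ z * ∑' φ : ballActions τ₀ C Γ', χ φ z :=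
        lintegral_mono_ae (hcount.mono fun z hz => le_mul_of_one_le_right' hz)
    _ = ∑' φ : ballActions τ₀ C Γ', ∫⁻ z in D, ρ z * χ φ z := by
        have hm : ∀ φ : ballActions τ₀ C Γ', AEMeasurable (fun z => ρ z * χ φ z) (volume.restrict D) :=
          fun φ => hρD.mul (hχm φ).aemeasurable
        rw [← lintegral_tsum hm]
        exact lintegral_congr fun z => ENNReal.tsum_mul_left.symm
    _ = ∑' φ : ballActions τ₀ C Γ',
          ∫⁻ z in D, ENNReal.ofReal (Complex.normSq (jacDetMap φ.1 z)) * D'.indicator ρ (φ.1 z) :=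
        tsum_congr fun φ => setLIntegral_congr_fun hD.1 (hpt φ)
    _ = ∑' φ : ballActions τ₀ C Γ', ∫⁻ w in φ.1 '' D, D'.indicator ρ w := by
        refine tsum_congr fun φ => ?_
        obtain ⟨M, hM, hφ⟩ := exists_unitaryJ_of_mem_ballActions hΓ hτ hC φ.2
        rw [hφ, lintegral_image_actM hM hD.1 hD.2.1]
    _ = ∫⁻ w in ball, D'.indicator ρ w := (lintegral_ball_eq_tsum_image_generic hΓ hτ hC hD _).symm
    _ = ∫⁻ w in D', ρ w := by
        rw [lintegral_indicator hD'.1, Measure.restrict_restrict hD'.1, Set.inter_eq_left.mpr hD'.2.1]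

/-- **THE TRANSFER, a.e.-measurable version.** -/
theorem lintegral_fundamentalDomain_eq_ae (hΓ : IsCongruenceSubgroup c H Γ') (hτ : ∀ x, τ₀ (c x) = conj (τ₀ x))
    (hC : IsSylvester (H.map τ₀) C) {D D' : Set (Fin 2 → ℂ)}
    (hD : IsFundamentalDomainFor (ballActions τ₀ C Γ') D) (hD' : IsFundamentalDomainFor (ballActions τ₀ C Γ') D')
    {ρ : (Fin 2 → ℂ) → ℝ≥0∞} (hρm : AEMeasurable ρ (volume.restrict ball)) (hρ : IsInvariantDensity τ₀ C Γ' ρ) :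
    ∫⁻ z in D, ρ z = ∫⁻ z in D', ρ z :=
  le_antisymm (lintegral_fundamentalDomain_le_ae hΓ hτ hC hD hD' hρm hρ)
    (lintegral_fundamentalDomain_le_ae hΓ hτ hC hD' hD hρm hρ)

end Transfer

end Summit.Ventures.HodgeRepro.Tier4.Line3

end
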